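import Summits.Ventures.Crystal3D.Theorems.StickyWulffConstantCoaxialWallLawExactCountAbs
import HarnessLib

/-!
# The exact source count with the plates abstracted — TOP EXITS COUNTED, not forbidden (F_layer OneFcc, file (B′))

HONEST FRAMING. Venture `Summits/Ventures/Crystal3D` (cell `crystal3d-full`); helper for the crux `CoaxialWallLaw` (stmt-Ventures-19481)
in its role as owner of lane T's debt T-F2 / F_layer, OneFcc half (cf-p1 (civ)/(cxx): «OneFcc = TWO FAMILIES»; plan memo
HOME/wall-19481-p1/g15/ONEFCC-ASSEMBLY-PLAN-g15.md §CORRECTION, g16 memo HOME/wall-19481-p1/g16/TWO-FAMILY-LEDGER-g16.md).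
Census-free, standard axioms; nothing about the crux is claimed; F-C1 not moved.

This is `word_sources_le_exact_plates_cell` (…ExactCountAbsPlatesCell, p692028) with the top hypothesis (S4') REPLACED: there a reachable
window state stepping into the top sealing band (heights `[h + R₀ + 1, h + R₀ + 2]`, lateral `≤ ρ − 2`) was IMPOSSIBLE (the receiving plate
admits no state of the family — the faulted plate's OPPOSITE tree against an fcc plate).  For the SECOND family of the OneFcc cell (the fcc
plate's OWN tree run into the faulted plate) such steps exist — at the faulted plate's `h`- and `c_D`-layer balls — and are COUNTED instead:

* (S4″) `hexitT` — a reachable window state stepping into the top band within lateral `ρ − 2` does so IN THE ROOT CLASS (`(f v).2 = root`;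
  for a Barlow receiving plate this is the core rigidity `word_eq_nil_of_face_plateBall`, p696331) onto a ball satisfying the abstract exit
  predicate `topOK` (the layer TYPE of the target, discharged by the cell);
* conclusion: `#sources ≤ #ends + #EXIT + M·#rims`, where **`EXIT` = the balls `b ∈ X` of the top band within lateral `ρ − 2` with `topOK b`
  whose root-predecessor `b − d root` lies below the band** (one per in-plane root line: the FIRST band ball of the line) — no multiplicity
  factor, because `f` is injective on moving states and the exit images all carry the root class.
(S1) `hsrc`, (S2') `hnoReentry`, (S3) `hsealB`, the `srcOK` filter and the other three terms are byte-identical to p692028; with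
`topOK := fun _ => False` the new term vanishes and (S4″) is (S4').  **`word_sources_le_exact_plates_exit`**.
WHAT THIS IS NOT: no plate-specific discharge here (the multi-root union, the Barlow discharge of (S4″) and the flux bound on `#EXIT` are the
next files); F-C1 not moved.
-/

noncomputable section

namespace Summit.Ventures.Crystal3D.Theorems

open Summit.Ventures.Crystal3D Finset
open scoped InnerProductSpace

variable {X : Finset (EuclideanSpace ℝ (Fin 3))}

section Core

variable {K : Type*} {F : K → (EuclideanSpace ℝ (Fin 3) ≃ₗᵢ[ℝ] EuclideanSpace ℝ (Fin 3))}
  {d : K → EuclideanSpace ℝ (Fin 3)}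
  {W : Finset (EuclideanSpace ℝ (Fin 3) × K)}
  {f : EuclideanSpace ℝ (Fin 3) × K → EuclideanSpace ℝ (Fin 3) × K}
  {root : K}
  {P' : Finset (EuclideanSpace ℝ (Fin 3))}
  {R₀ h ρ : ℝ} {M : ℕ} {P : EuclideanSpace ℝ (Fin 3) × K → Prop}

open scoped Classical in
/-- **The exact count with the plates abstracted; top exits COUNTED (one per root line), not forbidden.**  See the module docstring. -/
theorem word_sources_le_exact_plates_exit (mov : EuclideanSpace ℝ (Fin 3) × K → Prop)
    (srcOK : EuclideanSpace ℝ (Fin 3) → Prop) (topOK : EuclideanSpace ℝ (Fin 3) → Prop)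
    (hW : ∀ v, v ∈ W ↔ (v.1 ∈ X ∧
      (∃ a ∈ fccSlots, ∃ a' ∈ fccSlots, ∃ a'' ∈ fccSlots,
        ⟪a, a'⟫_ℝ = 1 / 2 ∧ ⟪a, a''⟫_ℝ = 1 / 2 ∧ ⟪a', a''⟫_ℝ = 1 / 2 ∧
        v.1 + F v.2 a ∈ X ∧ v.1 + F v.2 a' ∈ X ∧ v.1 + F v.2 a'' ∈ X) ∧
      v.1 - d v.2 ∈ X))
    (hmult : ∀ b ∈ X, (W.filter fun v => v.1 = b).card ≤ M)
    (htarget : ∀ v ∈ W, mov v → f v ∈ W ∧ (f v).1 - d (f v).2 = v.1 ∧ dist v.1 (f v).1 = 1)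
    (hinjW : Set.InjOn f {v | v ∈ W ∧ mov v})
    -- (S1) SOURCES: the admissible balls of the core are root states, moving, stepping straight, carrying the invariant
    (hsrc : ∀ p ∈ P', srcOK p → (p, root) ∈ W ∧ mov (p, root) ∧ f (p, root) = (p + d root, root) ∧ P (p + d root, root))
    (hPmov : ∀ v ∈ W, mov v → P v → P (f v))
    -- (S2) NO RE-ENTRY: a reachable state INSIDE THE WINDOW never steps onto a core ball
    (hnoReentry : ∀ v ∈ W, mov v → P v → -R₀ - 1 ≤ v.1 2 → v.1 2 < h + R₀ + 1 → (f v).1 ∉ P')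
    (hR₀ : 3 ≤ R₀) (hρ : R₀ ≤ ρ)
    (hP'top : ∀ p ∈ P', p 2 ≤ -R₀ - 1)
    -- (S3) BOTTOM SEALING: a ball of `X` strictly below the window, NOT in the core, within lateral `ρ − 1`, at height `≥ −R₀ − 2`: impossible
    (hsealB : ∀ s ∈ X, s ∉ P' → -R₀ - 1 - 1 ≤ s 2 → s 2 < -R₀ - 1 → s 0 ^ 2 + s 1 ^ 2 ≤ (ρ - 1) ^ 2 → False)
    -- (S4″) TOP EXITS ARE ROOT-CLASS STEPS ONTO ADMISSIBLE BALLS: a reachable window state stepping into the top band within lateral `ρ − 2`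
    -- carries the root class at the target, and the target satisfies `topOK`
    (hexitT : ∀ v ∈ W, mov v → P v → -R₀ - 1 ≤ v.1 2 → v.1 2 < h + R₀ + 1 →
      h + R₀ + 1 ≤ (f v).1 2 → (f v).1 2 ≤ h + R₀ + 1 + 1 → (f v).1 0 ^ 2 + (f v).1 1 ^ 2 ≤ (ρ - 2) ^ 2 →
      (f v).2 = root ∧ topOK (f v).1) :
    (P'.filter fun p => srcOK p ∧
        -R₀ - 1 < (p + d root) 2 ∧ (p + d root) 2 < h + R₀ + 1).card ≤
      (W.filter fun v => -R₀ - 1 ≤ v.1 2 ∧ v.1 2 < h + R₀ + 1 ∧ ¬ mov v ∧ P v ∧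
          ∃ u ∈ W, mov u ∧ f u = v).card +
      (X.filter fun b => h + R₀ + 1 ≤ b 2 ∧ b 2 ≤ h + R₀ + 1 + 1 ∧ b 0 ^ 2 + b 1 ^ 2 ≤ (ρ - 2) ^ 2 ∧
          (b - d root) 2 < h + R₀ + 1 ∧ topOK b).card +
      M * (X.filter fun s => h + R₀ + 1 ≤ s 2 ∧ s 2 ≤ h + R₀ + 1 + 1 ∧ (ρ - 2) ^ 2 < s 0 ^ 2 + s 1 ^ 2).card +
      M * (X.filter fun s => -R₀ - 1 - 1 ≤ s 2 ∧ s 2 < -R₀ - 1 ∧ (ρ - 1) ^ 2 < s 0 ^ 2 + s 1 ^ 2).card := by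
  have hr : 0 < Real.sqrt (2 / 3) := Real.sqrt_pos.2 (by norm_num)
  have hρ1 : (1 : ℝ) ≤ ρ := by linarith
  set zlo : ℝ := -R₀ - 1 with hzlo
  set zcut : ℝ := h + R₀ + 1 with hzcut
  set V := W.filter fun v => zlo ≤ v.1 2 ∧ v.1 2 < zcut ∧ v.1 ∉ P' with hV
  set SRC := P'.filter fun p => srcOK p ∧
      -R₀ - 1 < (p + d root) 2 ∧ (p + d root) 2 < h + R₀ + 1 with hSRC
  set S := SRC.image fun p => (p, root) with hS
  have hSW : ∀ p ∈ SRC, (p, root) ∈ W := fun p hp =>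
    (hsrc p (mem_filter.1 hp).1 (mem_filter.1 hp).2.1).1
  have hSmov : ∀ p ∈ SRC, mov (p, root) := fun p hp =>
    (hsrc p (mem_filter.1 hp).1 (mem_filter.1 hp).2.1).2.1
  have hSf : ∀ p ∈ SRC, f (p, root) = (p + d root, root) := fun p hp =>
    (hsrc p (mem_filter.1 hp).1 (mem_filter.1 hp).2.1).2.2.1
  have hP'top' : ∀ p ∈ P', p 2 ≤ zlo := fun p hp => by rw [hzlo]; exact hP'top p hp
  -- (1) the orbit-restricted count
  obtain ⟨Q, hQ⟩ : ∃ Q : EuclideanSpace ℝ (Fin 3) × K → Prop, ∀ v, Q v ↔ (P v ∧ ∃ u ∈ W, mov u ∧ f u = v) :=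
    ⟨_, fun v => Iff.rfl⟩
  have hcount := card_sources_le_ends_add_exits_of_invariant V S f mov Q ?inj ?disj ?src ?ps ?pst
  rotate_left
  · -- injectivity on the moving states of `V ∪ S`
    intro x hx y hy hxy
    have hxW : x ∈ W ∧ mov x := by
      rcases hx.1 with h | h
      · exact ⟨(mem_filter.1 h).1, hx.2⟩
      · obtain ⟨p, hp, rfl⟩ := mem_image.1 h; exact ⟨hSW p hp, hx.2⟩
    have hyW : y ∈ W ∧ mov y := by
      rcases hy.1 with h | h
      · exact ⟨(mem_filter.1 h).1, hy.2⟩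
      · obtain ⟨p, hp, rfl⟩ := mem_image.1 h; exact ⟨hSW p hp, hy.2⟩
    exact hinjW hxW hyW hxy
  · -- sources are not windowed states
    rw [Finset.disjoint_left]
    intro s hs hsV
    obtain ⟨p, hp, rfl⟩ := mem_image.1 hs
    exact (mem_filter.1 hsV).2.2.2 (mem_filter.1 hp).1
  · -- sources move into `V`
    intro s hs
    obtain ⟨p, hp, rfl⟩ := mem_image.1 hs
    refine ⟨hSmov p hp, ?_⟩
    obtain ⟨-, -, hlo, hhi⟩ := mem_filter.1 hp
    have hfv : f (p, root) = (p + d root, root) := hSf p hp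
    obtain ⟨hW', -, -⟩ := htarget _ (hSW p hp) (hSmov p hp)
    rw [hfv] at hW' ⊢
    rw [hV, mem_filter]
    refine ⟨hW', by rw [hzlo]; linarith, by rw [hzcut]; linarith, fun hP => ?_⟩
    have := hP'top' _ hP
    simp only at this
    linarith
  · -- the invariant at the first image of a source
    intro s hs
    obtain ⟨p, hp, rfl⟩ := mem_image.1 hs
    obtain ⟨hpP', hok, -, -⟩ := mem_filter.1 hp
    refine (hQ _).2 ⟨?_, (p, root), hSW p hp, hSmov p hp, rfl⟩
    rw [hSf p hp]
    exact (hsrc p hpP' hok).2.2.2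
  · -- the invariant is preserved inside the window
    intro v hv hm _ hP
    exact (hQ _).2 ⟨hPmov v (mem_filter.1 hv).1 hm ((hQ v).1 hP).1, v, (mem_filter.1 hv).1, hm, rfl⟩
  -- (2) the number of sources
  have hScard : S.card = SRC.card := by
    rw [hS, card_image_of_injective]
    intro p q hpq; exact (Prod.mk.inj hpq).1
  obtain ⟨E₁, E₂, hcount', hE₁, hE₂⟩ : ∃ E₁ E₂ : Finset (EuclideanSpace ℝ (Fin 3) × K),
      S.card ≤ E₁.card + E₂.card ∧
      (∀ v, v ∈ E₁ ↔ v ∈ V ∧ (¬ mov v ∧ Q v)) ∧ (∀ v, v ∈ E₂ ↔ v ∈ V ∧ (mov v ∧ f v ∉ V ∧ Q v)) :=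
    ⟨_, _, hcount, fun v => mem_filter, fun v => mem_filter⟩
  -- (3) the reachable ends, uncharged
  have hends : E₁.card ≤
      (W.filter fun v => zlo ≤ v.1 2 ∧ v.1 2 < zcut ∧ ¬ mov v ∧ P v ∧ ∃ u ∈ W, mov u ∧ f u = v).card := by
    refine card_le_card fun v hv => ?_
    obtain ⟨hvV, hnm, hQv⟩ := (hE₁ v).1 hv
    obtain ⟨hPv, hu⟩ := (hQ v).1 hQv
    obtain ⟨hvW, h1, h2, -⟩ := mem_filter.1 hvV
    exact mem_filter.2 ⟨hvW, h1, h2, hnm, hPv, hu⟩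
  -- (4) exits (reachable: they carry the invariant)
  set EX := V.filter fun v => mov v ∧ f v ∉ V ∧ Q v with hEX
  set RIMT := X.filter fun s => zcut ≤ s 2 ∧ s 2 ≤ zcut + 1 ∧ (ρ - 2) ^ 2 < s 0 ^ 2 + s 1 ^ 2 with hRIMT
  set RIMB := X.filter fun s => zlo - 1 ≤ s 2 ∧ s 2 < zlo ∧ (ρ - 1) ^ 2 < s 0 ^ 2 + s 1 ^ 2 with hRIMB
  set EXIT := X.filter fun b => zcut ≤ b 2 ∧ b 2 ≤ zcut + 1 ∧ b 0 ^ 2 + b 1 ^ 2 ≤ (ρ - 2) ^ 2 ∧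
      (b - d root) 2 < zcut ∧ topOK b with hEXIT
  have hexit : ∀ v ∈ EX, v ∈ W ∧ mov v ∧ zlo ≤ v.1 2 ∧ v.1 2 < zcut ∧ f v ∈ W ∧
      (f v).1 - d (f v).2 = v.1 ∧ dist v.1 (f v).1 = 1 ∧
      ((f v).1 2 < zlo ∨ zcut ≤ (f v).1 2 ∨ (f v).1 ∈ P') := by
    intro v hv
    obtain ⟨hvV, hm, hnot, -⟩ := mem_filter.1 hv
    obtain ⟨hvW, h1, h2, -⟩ := mem_filter.1 hvV
    obtain ⟨hW', hback, hdist⟩ := htarget v hvW hm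
    refine ⟨hvW, hm, h1, h2, hW', hback, hdist, ?_⟩
    by_contra hno
    push Not at hno
    exact hnot (by rw [hV, mem_filter]; exact ⟨hW', hno.1, hno.2.1, hno.2.2⟩)
  have hvert : ∀ v ∈ EX, |(f v).1 2 - v.1 2| ≤ 1 := by
    intro v hv
    obtain ⟨-, -, -, -, -, -, hdist, -⟩ := hexit v hv
    have h1 := sq_sub_apply_le_dist_sq (f v).1 v.1 2
    rw [dist_comm, hdist, one_pow] at h1
    rw [← sq_le_one_iff_abs_le_one]; exact h1
  have hnoP' : ∀ v ∈ EX, (f v).1 ∉ P' := by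
    intro v hv
    have hPv : P v := ((hQ v).1 (mem_filter.1 hv).2.2.2).1
    obtain ⟨hvW, hm, hlo, hhi, -, -, -, -⟩ := hexit v hv
    exact hnoReentry v hvW hm hPv hlo hhi
  have hbot : ∀ v ∈ EX, (f v).1 2 < zlo → (f v).1 ∈ RIMB := by
    intro v hv hlt
    obtain ⟨-, -, h1, -, hW', -, -, -⟩ := hexit v hv
    have hab := abs_le.1 (hvert v hv)
    have hsX : (f v).1 ∈ X := ((hW _).1 hW').1
    rw [hRIMB, mem_filter]
    refine ⟨hsX, by linarith [hab.1], hlt, ?_⟩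
    by_contra hlat
    push Not at hlat
    exact hsealB _ hsX (hnoP' v hv) (by rw [hzlo] at hlt h1; linarith [hab.1]) (by rw [hzlo] at hlt; exact hlt) hlat
  have htopc : ∀ v ∈ EX, zcut ≤ (f v).1 2 → (f v).1 ∈ RIMT ∨ ((f v).1 ∈ EXIT ∧ (f v).2 = root) := by
    intro v hv hge
    have hPv : P v := ((hQ v).1 (mem_filter.1 hv).2.2.2).1
    obtain ⟨hvW0, hm0, h1, h2, hW', hback, -, -⟩ := hexit v hv
    have hab := abs_le.1 (hvert v hv)
    have hsX : (f v).1 ∈ X := ((hW _).1 hW').1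
    have hs2 : (f v).1 2 ≤ zcut + 1 := by linarith [hab.2]
    by_cases hlat : (f v).1 0 ^ 2 + (f v).1 1 ^ 2 ≤ (ρ - 2) ^ 2
    · right
      obtain ⟨hroot, hok⟩ := hexitT v hvW0 hm0 hPv h1 h2 (by rw [hzcut] at hge; exact hge)
        (by rw [hzcut] at hs2; exact hs2) hlat
      refine ⟨?_, hroot⟩
      rw [hEXIT, mem_filter]
      refine ⟨hsX, hge, hs2, hlat, ?_, hok⟩
      rw [hroot] at hback
      rw [hback]; exact h2
    · left
      push Not at hlat
      rw [hRIMT, mem_filter]; exact ⟨hsX, hge, hs2, hlat⟩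
  -- (5) counting the exits
  have hEXinj : Set.InjOn f ↑EX := by
    intro x hx y hy hxy
    have hx' := mem_filter.1 (Finset.mem_coe.1 hx)
    have hy' := mem_filter.1 (Finset.mem_coe.1 hy)
    exact hinjW ⟨(mem_filter.1 hx'.1).1, hx'.2.1⟩ ⟨(mem_filter.1 hy'.1).1, hy'.2.1⟩ hxy
  have hfibre : ∀ T : Finset (EuclideanSpace ℝ (Fin 3)), T ⊆ X →
      (W.filter fun v => v.1 ∈ T).card ≤ M * T.card := by
    intro T hT
    have hcov : (W.filter fun v => v.1 ∈ T) ⊆ T.biUnion fun s => W.filter fun v => v.1 = s := by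
      intro v hv
      rw [mem_biUnion]
      exact ⟨v.1, (mem_filter.1 hv).2, mem_filter.2 ⟨(mem_filter.1 hv).1, rfl⟩⟩
    refine (card_le_card hcov).trans (card_biUnion_le.trans ?_)
    calc ∑ s ∈ T, (W.filter fun v => v.1 = s).card ≤ ∑ s ∈ T, M := sum_le_sum fun s hs => hmult s (hT hs)
      _ = M * T.card := by rw [sum_const, smul_eq_mul, mul_comm]
  have hexits : EX.card ≤ EXIT.card + M * RIMT.card + M * RIMB.card := by
    set EXR := EX.filter fun v => (f v).1 ∈ RIMT with hEXR
    set EXB := EX.filter fun v => (f v).1 ∈ RIMB with hEXB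
    set EXT := EX.filter fun v => (f v).1 ∈ EXIT ∧ (f v).2 = root with hEXT
    have hsplit : EX ⊆ EXR ∪ EXB ∪ EXT := by
      intro v hv
      obtain ⟨-, -, -, -, -, -, -, hcase⟩ := hexit v hv
      rw [mem_union, mem_union]
      rcases hcase with hlt | hge | hP
      · exact Or.inl (Or.inr (mem_filter.2 ⟨hv, hbot v hv hlt⟩))
      · rcases htopc v hv hge with hr | ht
        · exact Or.inl (Or.inl (mem_filter.2 ⟨hv, hr⟩))
        · exact Or.inr (mem_filter.2 ⟨hv, ht⟩)
      · exact absurd hP (hnoP' v hv)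
    have h1 : EXT.card ≤ EXIT.card := by
      refine card_le_card_of_injOn (fun v => (f v).1) (fun v hv => (mem_filter.1 hv).2.1) fun x hx y hy hxy => ?_
      have hx' := mem_filter.1 (Finset.mem_coe.1 hx)
      have hy' := mem_filter.1 (Finset.mem_coe.1 hy)
      refine hEXinj (Finset.mem_coe.2 hx'.1) (Finset.mem_coe.2 hy'.1) ?_
      exact Prod.ext hxy (by rw [hx'.2.2, hy'.2.2])
    have h2 : EXR.card ≤ M * RIMT.card := by
      refine le_trans ?_ (hfibre RIMT (filter_subset _ _))
      refine card_le_card_of_injOn f (fun v hv => ?_) fun x hx y hy hxy =>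
        hEXinj (Finset.mem_coe.2 (mem_filter.1 (Finset.mem_coe.1 hx)).1)
          (Finset.mem_coe.2 (mem_filter.1 (Finset.mem_coe.1 hy)).1) hxy
      obtain ⟨hvE, hr'⟩ := mem_filter.1 hv
      obtain ⟨-, -, -, -, hW', -, -, -⟩ := hexit v hvE
      exact mem_filter.2 ⟨hW', hr'⟩
    have h3 : EXB.card ≤ M * RIMB.card := by
      refine le_trans ?_ (hfibre RIMB (filter_subset _ _))
      refine card_le_card_of_injOn f (fun v hv => ?_) fun x hx y hy hxy =>
        hEXinj (Finset.mem_coe.2 (mem_filter.1 (Finset.mem_coe.1 hx)).1)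
          (Finset.mem_coe.2 (mem_filter.1 (Finset.mem_coe.1 hy)).1) hxy
      obtain ⟨hvE, hr'⟩ := mem_filter.1 hv
      obtain ⟨-, -, -, -, hW', -, -, -⟩ := hexit v hvE
      exact mem_filter.2 ⟨hW', hr'⟩
    calc EX.card ≤ (EXR ∪ EXB ∪ EXT).card := card_le_card hsplit
      _ ≤ (EXR ∪ EXB).card + EXT.card := card_union_le _ _
      _ ≤ EXR.card + EXB.card + EXT.card := by linarith [card_union_le EXR EXB]
      _ ≤ EXIT.card + M * RIMT.card + M * RIMB.card := by linarith
  -- (6) assemble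
  rw [← hScard]
  have hE₂EX : E₂.card ≤ EX.card := by
    refine card_le_card fun v hv => ?_
    obtain ⟨hvV, hm, hfv, hQv⟩ := (hE₂ v).1 hv
    rw [hEX, mem_filter]
    exact ⟨hvV, hm, hfv, hQv⟩
  calc S.card ≤ E₁.card + E₂.card := hcount'
    _ ≤ _ := by
      rw [hzlo, hzcut] at hends
      rw [hEXIT, hRIMT, hRIMB, hzlo, hzcut] at hexits
      linarith [hends, hexits, hE₂EX]

end Core

end Summit.Ventures.Crystal3D.Theorems

end
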